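import Mathlib.Analysis.Calculus.SmoothSeries
import Mathlib.Analysis.Calculus.Deriv.Pow
import Mathlib.Analysis.Calculus.MeanValue
import Mathlib.Analysis.SpecialFunctions.ExpDeriv
import Mathlib.Analysis.SpecificLimits.Normed
import Mathlib.Analysis.Normed.Ring.InfiniteSum
import HarnessLib

/-!
# `Z = Z(0) · exp C` from the linked-cluster recursion `k b_k = Σ_{j+m=k} j c_j b_m`

The analytic half of the linked-cluster theorem for a perturbation series (Brydges 1986, §2;
Benfatto–Giuliani–Mastropietro 2006, (2.13); Ruelle 1969, §4.4): if the coefficients `b_k` of a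
"partition function" `Z(U) = Σ_k b_k U^k` and the "connected" coefficients `c_j` (with `c_0 = 0`)
satisfy the recursion `k · b_k = Σ_{j+m=k} j · c_j · b_m` for every `k` (the coefficient form of
`Z' = C' Z`, e.g. `VacuumLinkedCluster.vacuum_linkedCluster_recursion`), and both series converge
absolutely on `|U| < R`, then

`Σ_k b_k U^k = b_0 · exp (Σ_j c_j U^j)` for `|U| < R`   (`tsum_eq_mul_exp_tsum_of_recursion`),

in particular `Z` has no zero in the disc when `b_0 ≠ 0`, and `log (Z(U)/b_0)` is the convergent series
`Σ_j c_j U^j` there. Proof: termwise differentiation of the two power series on smaller discs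
(`hasDerivAt_tsum_of_isPreconnected`), the Cauchy product for `C'·Z` and the recursion give `Z' = C' Z`;
hence `Z e^{-C}` has zero derivative on the (connected) disc and equals its value `b_0` at `0`.

* `summable_succ_mul_of_summable_pow` — `Σ ‖a_{k+1}‖ (k+1) rᵏ < ∞` below the radius;
* `hasDerivAt_tsum_mul_pow` — termwise derivative of `Σ a_k Uᵏ` inside the disc of absolute convergence;
* `tsum_eq_mul_exp_tsum_of_recursion` — the statement above.

Everything is PROVED; no definition. [folklore]

## References
* D. C. Brydges, *A short course on cluster expansions*, Les Houches 1984, §2. [cite: Brydges1986, §2]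
* D. Ruelle, *Statistical Mechanics: Rigorous Results* (1969), §4.4. [cite: Ruelle1969, §4.4]
-/

noncomputable section

open Finset Filter Metric Set
open scoped Topology

namespace Literature.Analysis.Complex

/-! ### Summability of the differentiated terms -/

/-- Below the radius of absolute convergence the differentiated terms are absolutely summable:
if `Σ ‖a_k‖ r'ᵏ < ∞` for some `r' > r ≥ 0` then `Σ ‖a_{k+1}‖ (k+1) rᵏ < ∞`. [folklore] -/
theorem summable_succ_mul_of_summable_pow {a : ℕ → ℂ} {r r' : ℝ} (hr : 0 ≤ r) (hrr' : r < r')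
    (ha : Summable fun k => ‖a k‖ * r' ^ k) :
    Summable fun k => ‖a (k + 1)‖ * ((k : ℝ) + 1) * r ^ k := by
  have hr' : 0 < r' := hr.trans_lt hrr'
  -- the bounded factor `‖a_{k+1}‖ r'^{k+1}`
  have hshift : Summable fun k => ‖a (k + 1)‖ * r' ^ (k + 1) :=
    (summable_nat_add_iff 1).mpr ha
  obtain ⟨B, hB⟩ : ∃ B, ∀ k, ‖a (k + 1)‖ * r' ^ (k + 1) ≤ B := by
    have hbdd := hshift.tendsto_atTop_zero.bddAbove_range
    obtain ⟨B, hB⟩ := hbdd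
    exact ⟨B, fun k => hB ⟨k, rfl⟩⟩
  have hB0 : 0 ≤ B := le_trans (by positivity) (hB 0)
  -- the summable factor `(k+1) q^k / r'`, `q = r/r' < 1`
  set q : ℝ := r / r' with hq
  have hq0 : 0 ≤ q := div_nonneg hr hr'.le
  have hq1 : ‖q‖ < 1 := by
    rw [Real.norm_of_nonneg hq0, hq, div_lt_one hr']
    exact hrr'
  have hgeo : Summable fun k : ℕ => ((k : ℝ) + 1) * q ^ k := by
    have h1 : Summable fun k : ℕ => ((k : ℝ) ^ 1 : ℝ) * q ^ k := summable_pow_mul_geometric_of_norm_lt_one 1 hq1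
    have h0 : Summable fun k : ℕ => q ^ k := summable_geometric_of_norm_lt_one hq1
    simpa [pow_one, add_mul] using h1.add h0
  refine Summable.of_nonneg_of_le (fun k => by positivity) (fun k => ?_) ((hgeo.mul_left (B / r')))
  -- `‖a_{k+1}‖ (k+1) r^k = (‖a_{k+1}‖ r'^{k+1}) · ((k+1) q^k / r')`
  have hident : ‖a (k + 1)‖ * ((k : ℝ) + 1) * r ^ k =
      (‖a (k + 1)‖ * r' ^ (k + 1)) * (((k : ℝ) + 1) * q ^ k / r') := by
    rw [hq, div_pow, pow_succ]
    field_simp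
  rw [hident]
  calc (‖a (k + 1)‖ * r' ^ (k + 1)) * (((k : ℝ) + 1) * q ^ k / r')
      ≤ B * (((k : ℝ) + 1) * q ^ k / r') :=
        mul_le_mul_of_nonneg_right (hB k) (by positivity)
    _ = B / r' * (((k : ℝ) + 1) * q ^ k) := by ring

/-! ### Termwise differentiation -/

/-- **Termwise derivative of a power series inside its disc of absolute convergence**: if
`Σ ‖a_k‖ rᵏ < ∞` for every `0 ≤ r < R`, then for `‖U‖ < R`,
`d/dU Σ_k a_k Uᵏ = Σ_k (k+1) a_{k+1} Uᵏ`. [folklore] -/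
theorem hasDerivAt_tsum_mul_pow {a : ℕ → ℂ} {R : ℝ}
    (ha : ∀ r : ℝ, 0 ≤ r → r < R → Summable fun k => ‖a k‖ * r ^ k) {U : ℂ} (hU : ‖U‖ < R) :
    HasDerivAt (fun z : ℂ => ∑' k, a k * z ^ k) (∑' k : ℕ, ((k : ℂ) + 1) * a (k + 1) * U ^ k) U := by
  -- radii `‖U‖ < r < r' < R`
  obtain ⟨r, hUr, hrR⟩ := exists_between hU
  obtain ⟨r', hrr', hr'R⟩ := exists_between hrR
  have hr0 : 0 ≤ r := (norm_nonneg _).trans hUr.le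
  have hsum := summable_succ_mul_of_summable_pow hr0 hrr' (ha r' (hr0.trans hrr'.le) hr'R)
  -- the bound `u k` on the derivative of the `k`-th term on the ball of radius `r`
  set u : ℕ → ℝ := fun k => Nat.casesOn k 0 fun k => ‖a (k + 1)‖ * ((k : ℝ) + 1) * r ^ k with hu
  have hu_summable : Summable u := by
    rw [← summable_nat_add_iff 1]
    exact hsum
  have hderiv : ∀ (k : ℕ) (y : ℂ), y ∈ ball (0 : ℂ) r →
      HasDerivAt (fun z : ℂ => a k * z ^ k) (a k * ((k : ℂ) * y ^ (k - 1))) y :=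
    fun k y _ => (hasDerivAt_pow k y).const_mul (a k)
  have hbound : ∀ (k : ℕ) (y : ℂ), y ∈ ball (0 : ℂ) r → ‖a k * ((k : ℂ) * y ^ (k - 1))‖ ≤ u k := by
    intro k y hy
    rw [mem_ball_zero_iff] at hy
    cases k with
    | zero => simp [hu]
    | succ k =>
      simp only [hu, Nat.add_sub_cancel, norm_mul, norm_pow]
      have hk : ‖((k + 1 : ℕ) : ℂ)‖ = (k : ℝ) + 1 := by
        rw [Complex.norm_natCast]; push_cast; ring
      rw [hk]
      have hyk : ‖y‖ ^ k ≤ r ^ k := pow_le_pow_left₀ (norm_nonneg _) hy.le k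
      calc ‖a (k + 1)‖ * (((k : ℝ) + 1) * ‖y‖ ^ k) ≤ ‖a (k + 1)‖ * (((k : ℝ) + 1) * r ^ k) := by
            gcongr
        _ = ‖a (k + 1)‖ * ((k : ℝ) + 1) * r ^ k := by ring
  have h0 : Summable fun k => a k * (0 : ℂ) ^ k := by
    refine summable_of_ne_finset_zero (s := {0}) fun k hk => ?_
    rw [Finset.mem_singleton] at hk
    simp [hk]
  have hmain := hasDerivAt_tsum_of_isPreconnected hu_summable isOpen_ball (convex_ball _ _).isPreconnected
    hderiv hbound (mem_ball_self ((norm_nonneg U).trans_lt hUr)) h0 (mem_ball_zero_iff.mpr hUr)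
  -- reindex the derivative series: the `k = 0` term vanishes
  have hre : ∑' k : ℕ, a k * ((k : ℂ) * U ^ (k - 1)) = ∑' k : ℕ, ((k : ℂ) + 1) * a (k + 1) * U ^ k := by
    have hs : Summable fun k => a k * ((k : ℂ) * U ^ (k - 1)) :=
      .of_norm_bounded hu_summable fun k => hbound k U (mem_ball_zero_iff.mpr hUr)
    rw [hs.tsum_eq_zero_add]
    simp only [Nat.cast_zero, zero_mul, mul_zero, zero_add, Nat.add_sub_cancel]
    refine tsum_congr fun k => ?_
    push_cast
    ring
  rw [hre] at hmain
  exact hmain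

/-! ### The exponential relation -/

/-- **`Z = Z(0) · exp C` from the linked-cluster recursion.** If `Σ ‖b_k‖ rᵏ` and `Σ ‖c_j‖ rʲ`
converge for all `0 ≤ r < R`, `c_0 = 0`, and `k · b_k = Σ_{j+m=k} j · c_j · b_m` for every `k`, then
for `‖U‖ < R`, `Σ_k b_k Uᵏ = b_0 · exp (Σ_j c_j Uʲ)`. (Termwise differentiation, the Cauchy product and
the recursion give `Z' = C'Z` on the disc; `Z e^{-C}` is then constant.) Brydges 1986 §2; Ruelle 1969
§4.4. [cite: Brydges1986, §2] -/
theorem tsum_eq_mul_exp_tsum_of_recursion {b c : ℕ → ℂ} {R : ℝ}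
    (hb : ∀ r : ℝ, 0 ≤ r → r < R → Summable fun k => ‖b k‖ * r ^ k)
    (hc : ∀ r : ℝ, 0 ≤ r → r < R → Summable fun j => ‖c j‖ * r ^ j)
    (hc0 : c 0 = 0)
    (hrec : ∀ k : ℕ, (k : ℂ) * b k = ∑ p ∈ antidiagonal k, (p.1 : ℂ) * c p.1 * b p.2)
    {U : ℂ} (hU : ‖U‖ < R) :
    ∑' k, b k * U ^ k = b 0 * Complex.exp (∑' j, c j * U ^ j) := by
  -- the two functions and their derivatives
  set Z : ℂ → ℂ := fun z => ∑' k, b k * z ^ k with hZ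
  set C : ℂ → ℂ := fun z => ∑' j, c j * z ^ j with hC
  set Z₁ : ℂ → ℂ := fun z => ∑' k : ℕ, ((k : ℂ) + 1) * b (k + 1) * z ^ k with hZ₁
  set C₁ : ℂ → ℂ := fun z => ∑' k : ℕ, ((k : ℂ) + 1) * c (k + 1) * z ^ k with hC₁
  have hZd : ∀ z : ℂ, ‖z‖ < R → HasDerivAt Z (Z₁ z) z := fun z hz => hasDerivAt_tsum_mul_pow hb hz
  have hCd : ∀ z : ℂ, ‖z‖ < R → HasDerivAt C (C₁ z) z := fun z hz => hasDerivAt_tsum_mul_pow hc hz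
  -- absolute summability at a point of the disc
  have hnormb : ∀ z : ℂ, ‖z‖ < R → Summable fun k => ‖b k * z ^ k‖ := fun z hz => by
    simpa [norm_mul, norm_pow] using hb ‖z‖ (norm_nonneg _) hz
  have hnormC₁ : ∀ z : ℂ, ‖z‖ < R → Summable fun k : ℕ => ‖((k : ℂ) + 1) * c (k + 1) * z ^ k‖ := by
    intro z hz
    obtain ⟨r', hzr', hr'R⟩ := exists_between hz
    have h := summable_succ_mul_of_summable_pow (norm_nonneg z) hzr' (hc r' ((norm_nonneg z).trans hzr'.le) hr'R)
    refine h.congr fun k => ?_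
    rw [norm_mul, norm_mul, norm_pow]
    have hk : ‖((k : ℂ) + 1)‖ = (k : ℝ) + 1 := by
      rw [show ((k : ℂ) + 1) = ((k + 1 : ℕ) : ℂ) by push_cast; ring, Complex.norm_natCast]
      push_cast; ring
    rw [hk]; ring
  -- `Z' = C' Z` on the disc: Cauchy product and the recursion
  have hODE : ∀ z : ℂ, ‖z‖ < R → C₁ z * Z z = Z₁ z := by
    intro z hz
    simp only [hC₁, hZ, hZ₁]
    rw [tsum_mul_tsum_eq_tsum_sum_antidiagonal_of_summable_norm (hnormC₁ z hz) (hnormb z hz)]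
    refine tsum_congr fun k => ?_
    -- the recursion at `k + 1`, with the vanishing `j = 0` term removed
    have hk := hrec (k + 1)
    rw [Finset.Nat.antidiagonal_succ, Finset.sum_cons, Finset.sum_map] at hk
    simp only [Nat.cast_zero, zero_mul, zero_add, Function.Embedding.coe_prodMap,
      Function.Embedding.coeFn_mk, Prod.map_fst, Prod.map_snd, Function.Embedding.refl_apply,
      Nat.succ_eq_add_one, Nat.cast_add, Nat.cast_one] at hk
    calc ∑ p ∈ antidiagonal k, ((p.1 : ℂ) + 1) * c (p.1 + 1) * z ^ p.1 * (b p.2 * z ^ p.2)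
        = (∑ p ∈ antidiagonal k, ((p.1 : ℂ) + 1) * c (p.1 + 1) * b p.2) * z ^ k := by
          rw [Finset.sum_mul]
          refine Finset.sum_congr rfl fun p hp => ?_
          have hpk : p.1 + p.2 = k := mem_antidiagonal.mp hp
          rw [← hpk, pow_add]
          ring
      _ = ((k : ℂ) + 1) * b (k + 1) * z ^ k := by rw [← hk]
  -- `F = Z e^{-C}` has zero derivative on the disc
  set F : ℂ → ℂ := fun z => Z z * Complex.exp (-C z) with hF
  have hFd : ∀ z : ℂ, ‖z‖ < R → HasDerivAt F 0 z := by
    intro z hz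
    have h1 : HasDerivAt (fun w => Z w * Complex.exp (-C w))
        (Z₁ z * Complex.exp (-C z) + Z z * (Complex.exp (-C z) * -C₁ z)) z :=
      (hZd z hz).mul (((hCd z hz).neg).cexp)
    have hzero : Z₁ z * Complex.exp (-C z) + Z z * (Complex.exp (-C z) * -C₁ z) = 0 := by
      rw [← hODE z hz]; ring
    rw [hzero] at h1
    exact h1
  have hFconst : F U = F 0 := by
    have hdiff : DifferentiableOn ℂ F (ball (0 : ℂ) R) := fun z hz =>
      (hFd z (mem_ball_zero_iff.mp hz)).differentiableAt.differentiableWithinAt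
    refine IsOpen.is_const_of_fderiv_eq_zero isOpen_ball (convex_ball _ _).isPreconnected hdiff
      (fun z hz => ?_) (mem_ball_zero_iff.mpr hU) (mem_ball_self ((norm_nonneg U).trans_lt hU))
    have h := (hFd z (mem_ball_zero_iff.mp hz)).hasFDerivAt.fderiv
    rw [h]
    ext
    simp
  -- evaluate at `0`
  have hZ0 : Z 0 = b 0 := by
    simp only [hZ]
    rw [tsum_eq_single 0 fun k hk => by simp [hk]]
    simp
  have hC0 : C 0 = 0 := by
    simp only [hC]
    rw [tsum_eq_single 0 fun k hk => by simp [hk]]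
    simp [hc0]
  have hF0 : F 0 = b 0 := by
    simp only [hF, hZ0, hC0, neg_zero, Complex.exp_zero, mul_one]
  -- conclude
  have hFU : F U = Z U * Complex.exp (-C U) := rfl
  have key : Z U = b 0 * Complex.exp (C U) := by
    have h := hFconst
    rw [hFU, hF0] at h
    calc Z U = Z U * Complex.exp (-C U) * Complex.exp (C U) := by
          rw [mul_assoc, ← Complex.exp_add, neg_add_cancel, Complex.exp_zero, mul_one]
      _ = b 0 * Complex.exp (C U) := by rw [h]
  exact key

end Literature.Analysis.Complex
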